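import Mathlib
import HarnessLib
import Literature.MathematicalPhysics.QuantumFieldTheory.ConstructiveQFTWave0
import Literature.MathematicalPhysics.QuantumLattice.AbelianMagneticFlux
import Literature.Topology.FourManifolds.TorusMapDegree
import Summits.Ventures.LatticeQCDFlow.Scaling.IsoperimetricTransfer
import Summits.Ventures.LatticeQCDFlow.Scaling.TopologicalCollar

/-!
# LatticeQCDFlow / Scaling — the flux-sector collar of compact `U(1)` in any dimension and the `1/ε` transport law (v2.6, (C2b′))

HONEST FRAMING: exact (Metropolis-corrected) sampling algorithms for lattice gauge theory; figures
of merit are autocorrelation/cost numbers at stated couplings and volumes; no continuum-physics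
claim.

`Scaling/TopologicalCollar.lean` proves the lattice half of the isoperimetric-transfer law (C2b′) of
THEORY-2.md §3.3 for the topological sectors of 2-d compact `U(1)`.  This file is its generalisation
to compact `U(1)` configurations `U : Edge d L → Circle` on the torus `(ℤ/L)^d` in ANY dimension `d`,
sup (chordal) metric, and the FLUX SECTORS through a coordinate plane `(μ, ν)` through a base point
`x₀` (Lüscher's flux quantum numbers `m_{μν}`; `d = 2`, `(μ, ν) = (0, 1)`: the topological sectors);
the chordal-geometry lemmas of §1 there are reused:
* `topCharge x₀ μ ν U = φ_{μν}(x₀)/(2π) = (2π)⁻¹ ∑_{s,t} F_{μν}(x₀ + sμ̂ + tν̂)`, Lüscher's magnetic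
  flux through the `(μ,ν)`-plane through `x₀` (`Literature…QuantumLattice.magneticFlux`, field tensor
  `F = arg U_p ∈ (−π, π]`), is an INTEGER (`exists_int_eq_topCharge`, from the Literature fact
  `exists_int_magneticFlux_eq`, [Luscher1999AbelianChiral, §2.2 (2.10)–(2.11)]).
* COLLAR INCLUSION (`union_thickening_diff_subset_collar`), VOLUME-UNIFORM: for `A = {Q ≤ 0}`,
  `(A ∪ A^r) \ A ⊆ collar μ ν (4r) = {U | ∃ x, ‖U_{μν}(x) + 1‖ ≤ 4r}`.  Proof: along the linkwise
  geodesic path from `U` to a configuration `U'` on the other side every configuration stays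
  within `r` of `U`; if no plaquette of `U` were `4r`-close to `−1`, none along the path would hit
  `−1`, the charge would be continuous and integer-valued along the path, hence could not pass
  from `≥ 1` to `≤ 0` (intermediate value `1/2`).
* Hence `μ(A ∪ A^r) ≤ μ(A) + μ(collar 4r)` for EVERY finite measure `μ`
  (`measureReal_union_thickening_le_collar`), and the abstract engine
  `Theory2.accurateTransport_lipschitz_ge` (`IsoperimetricTransfer.lean`) yields the
  **topological transport law** `accurateTransport_lipschitz_ge_collar`: prior `γ` with linear
  isoperimetric profile `(a, b, c)`, `T` `K`-Lipschitz with push-forward `ε`-close to `μ` on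
  measurable sets, window `a ≤ μ(A) − ε`, `μ(A) + ε + μ(collar 4r) < b` ⟹
  `c·r ≤ K·(2ε + μ(collar 4r))`; exact case `exactTransport_lipschitz_ge_collar`.
NOT typed here (THEORY-2.md §3.3): the profile `(0.3, 0.8, 0.112)` of product Haar on `Circle^E`
(Gaussian isoperimetry through the `√(2π)`-Lipschitz map `Φ ↦ e^{2πiΦ}`; Borell,
Sudakov–Tsirelson; Salmona et al. arXiv:2206.14476 Thm 1) — the hypothesis `hγ` — and the
one-plaquette collar mass `μ_β(collar η) ≤ #P·q_β(η)` of the Wilson measure.  Reused: the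
chordal geometry of `Circle` and the `4`-Lipschitz plaquette map (`Circle.dist_exp_mul_le_of_mem_Icc`,
`dist_plaquetteHolonomy_le`, `continuous_plaquetteHolonomy`, `TopologicalCollar.lean`;
`U1.dist_eq_norm_coe`, `CircleBallVolume.lean`), `arg` continuity off `−1`
(`Circle.mem_slitPlane_of_ne_neg_one`, `Literature…TorusMapDegree`), flux quantisation
(`Literature…AbelianMagneticFlux`).
-/


noncomputable section

namespace Summit.Ventures.LatticeQCDFlow.Theory2.Lattice.Flux

open MeasureTheory Metric Set Filter Topology Real
open Literature.MathematicalPhysics.QuantumFieldTheory Literature.MathematicalPhysics.QuantumLattice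

/-! ## §1. The flux charge of an abelian configuration through a coordinate plane is an integer -/

section Charge

variable {d L : ℕ} [NeZero L]

/-- The topological (flux) charge of a compact `U(1)` configuration through the `(μ,ν)`-plane through
`x₀`: Lüscher's magnetic flux `Q = φ_{μν}(x₀)/(2π) = (2π)⁻¹ ∑_{s,t} F_{μν}(x₀ + sμ̂ + tν̂)`,
`F_{μν} = arg U_p ∈ (−π, π]`; for `d = 2` this is the topological charge of the configuration.
[cite: Luscher1999AbelianChiral, §2.2, eq. (2.10)] -/
def topCharge (x₀ : Site d L) (μ ν : Fin d) (U : GaugeConfig d L Circle) : ℝ :=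
  magneticFlux U x₀ μ ν / (2 * π)

/-- The flux charge is an integer (flux quantisation). [cite: Luscher1999AbelianChiral, §2.2, eq. (2.11)] -/
theorem exists_int_eq_topCharge (x₀ : Site d L) (μ ν : Fin d) (U : GaugeConfig d L Circle) :
    ∃ n : ℤ, topCharge x₀ μ ν U = n := by
  obtain ⟨n, hn⟩ := exists_int_magneticFlux_eq U x₀ μ ν
  refine ⟨n, ?_⟩
  have hπ : (2 : ℝ) * π ≠ 0 := by positivity
  rw [topCharge, hn]
  field_simp

/-- A configuration of positive charge has charge at least one. [folklore] -/
theorem one_le_topCharge_of_pos {x₀ : Site d L} {μ ν : Fin d} {U : GaugeConfig d L Circle}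
    (h : 0 < topCharge x₀ μ ν U) : 1 ≤ topCharge x₀ μ ν U := by
  obtain ⟨n, hn⟩ := exists_int_eq_topCharge x₀ μ ν U
  rw [hn] at h ⊢
  have h0 : (0 : ℤ) < n := by exact_mod_cast h
  have h1 : (1 : ℤ) ≤ n := by omega
  exact_mod_cast h1

/-- The charge `1/2` does not occur. [folklore] -/
theorem topCharge_ne_half (x₀ : Site d L) (μ ν : Fin d) (U : GaugeConfig d L Circle) :
    topCharge x₀ μ ν U ≠ 1 / 2 := by
  obtain ⟨n, hn⟩ := exists_int_eq_topCharge x₀ μ ν U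
  rw [hn]
  intro h
  have h2 : ((2 * n : ℤ) : ℝ) = ((1 : ℤ) : ℝ) := by push_cast; linarith
  have h3 : 2 * n = 1 := by exact_mod_cast h2
  omega

/-- The flux charge is measurable. [folklore] -/
theorem measurable_topCharge (x₀ : Site d L) (μ ν : Fin d) :
    Measurable (topCharge (L := L) x₀ μ ν) := by
  unfold topCharge magneticFlux abelianFieldTensor
  refine Measurable.div_const (Finset.measurable_sum _ fun s _ =>
    Finset.measurable_sum _ fun t _ => ?_) _
  exact Complex.measurable_arg.comp
    (continuous_subtype_val.comp (continuous_plaquetteHolonomy _ μ ν)).measurable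

/-- The flux half-space `{Q ≤ 0}` is measurable. [folklore] -/
theorem measurableSet_topCharge_le (x₀ : Site d L) (μ ν : Fin d) :
    MeasurableSet {U : GaugeConfig d L Circle | topCharge x₀ μ ν U ≤ 0} :=
  measurable_topCharge x₀ μ ν measurableSet_Iic

end Charge

/-! ## §2. The linkwise geodesic path and the collar inclusion -/

section Collar

variable {d L : ℕ} [NeZero L]

/-- The linkwise geodesic path from `U` (`t = 0`) to `U'` (`t = 1`). [folklore] -/
def anglePath (U U' : GaugeConfig d L Circle) (t : ℝ) : GaugeConfig d L Circle :=
  fun e => Circle.exp (t * Complex.arg ((U' e / U e : Circle) : ℂ)) * U e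

omit [NeZero L] in
/-- The path starts at `U`. [folklore] -/
theorem anglePath_zero (U U' : GaugeConfig d L Circle) : anglePath U U' 0 = U := by
  funext e; simp [anglePath, Circle.exp_zero]

omit [NeZero L] in
/-- The path ends at `U'`. [folklore] -/
theorem anglePath_one (U U' : GaugeConfig d L Circle) : anglePath U U' 1 = U' := by
  funext e
  simp only [anglePath, one_mul, Circle.exp_arg]
  exact div_mul_cancel (U' e) (U e)

/-- Every configuration on the path is within `dist U' U` of `U` (sup metric). [folklore] -/
theorem dist_anglePath_le (U U' : GaugeConfig d L Circle) {t : ℝ} (ht : t ∈ Icc (0 : ℝ) 1) :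
    dist (anglePath U U' t) U ≤ dist U' U := by
  refine (dist_pi_le_iff dist_nonneg).2 fun e => ?_
  have hδ : |Complex.arg ((U' e / U e : Circle) : ℂ)| ≤ π :=
    abs_le.2 ⟨(Complex.neg_pi_lt_arg _).le, Complex.arg_le_pi _⟩
  have hU' : U' e = Circle.exp (Complex.arg ((U' e / U e : Circle) : ℂ)) * U e := by
    rw [Circle.exp_arg]; exact (div_mul_cancel (U' e) (U e)).symm
  calc dist (anglePath U U' t e) (U e)
      = dist (Circle.exp (t * Complex.arg ((U' e / U e : Circle) : ℂ)) * U e) (U e) := rfl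
    _ ≤ dist (Circle.exp (Complex.arg ((U' e / U e : Circle) : ℂ)) * U e) (U e) :=
        Circle.dist_exp_mul_le_of_mem_Icc hδ ht (U e)
    _ = dist (U' e) (U e) := by rw [← hU']
    _ ≤ dist U' U := dist_le_pi_dist U' U e

omit [NeZero L] in
/-- The path is continuous in `t`. [folklore] -/
theorem continuous_anglePath (U U' : GaugeConfig d L Circle) : Continuous (anglePath U U') := by
  refine continuous_pi fun e => ?_
  exact (Circle.exp.continuous.comp (continuous_id.mul continuous_const)).mul continuous_const

/-- The `s`-collar of the flux-sector boundary: some `(μ,ν)`-plaquette is within chordal distance `s`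
of `−1` (plaquette angle within `≈ s` of `π`). [folklore] -/
def collar (μ ν : Fin d) (s : ℝ) : Set (GaugeConfig d L Circle) :=
  {U | ∃ x : Site d L, ‖((plaquetteHolonomy U x μ ν : Circle) : ℂ) + 1‖ ≤ s}

/-- **Collar inclusion (volume-uniform).**  A configuration of positive charge within sup-distance
`r` of a configuration of non-positive charge has a plaquette within chordal distance `4r` of `−1`:
`(A ∪ A^r) \ A ⊆ collar (4r)` for `A = {Q ≤ 0}`. [folklore] -/
theorem union_thickening_diff_subset_collar (x₀ : Site d L) (μ ν : Fin d) (r : ℝ) :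
    ({U : GaugeConfig d L Circle | topCharge x₀ μ ν U ≤ 0} ∪
        thickening r {U : GaugeConfig d L Circle | topCharge x₀ μ ν U ≤ 0}) \
      {U | topCharge x₀ μ ν U ≤ 0} ⊆ collar μ ν (4 * r) := by
  rintro U ⟨hU, hUA⟩
  have hUA' : ¬ topCharge x₀ μ ν U ≤ 0 := hUA
  rcases hU with hU | hU
  · exact absurd hU hUA'
  rw [mem_thickening_iff] at hU
  obtain ⟨U', hU'A, hUU'⟩ := hU
  have hU'A' : topCharge x₀ μ ν U' ≤ 0 := hU'A
  by_contra hcol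
  have hfar : ∀ x : Site d L, 4 * r < ‖((plaquetteHolonomy U x μ ν : Circle) : ℂ) + 1‖ := by
    intro x; by_contra hx; exact hcol ⟨x, not_lt.mp hx⟩
  -- along the linkwise geodesic path no plaquette hits `-1`
  have hne : ∀ t ∈ Icc (0 : ℝ) 1, ∀ x : Site d L,
      plaquetteHolonomy (anglePath U U' t) x μ ν ≠ -1 := by
    intro t ht x hx
    have hd : dist (plaquetteHolonomy (anglePath U U' t) x μ ν) (plaquetteHolonomy U x μ ν) < 4 * r :=
      calc dist (plaquetteHolonomy (anglePath U U' t) x μ ν) (plaquetteHolonomy U x μ ν)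
          ≤ 4 * dist (anglePath U U' t) U := dist_plaquetteHolonomy_le _ _ _ _ _
        _ ≤ 4 * dist U' U := by linarith [dist_anglePath_le U U' ht]
        _ < 4 * r := by rw [dist_comm]; linarith
    have h' : ‖((-1 : Circle) : ℂ) - ((plaquetteHolonomy U x μ ν : Circle) : ℂ)‖ < 4 * r := by
      rw [← U1.dist_eq_norm_coe, ← hx]; exact hd
    have e : ((-1 : Circle) : ℂ) - ((plaquetteHolonomy U x μ ν : Circle) : ℂ) =
        -(((plaquetteHolonomy U x μ ν : Circle) : ℂ) + 1) := by
      rw [Circle.coe_neg, Circle.coe_one]; ring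
    rw [e, norm_neg] at h'
    exact absurd h' (not_lt.mpr (hfar x).le)
  -- hence the charge is continuous along the path
  have hF : ∀ x : Site d L,
      ContinuousOn (fun t => abelianFieldTensor (anglePath U U' t) x μ ν) (Icc (0 : ℝ) 1) := by
    intro x t ht
    have hc : Continuous fun s => ((plaquetteHolonomy (anglePath U U' s) x μ ν : Circle) : ℂ) :=
      continuous_subtype_val.comp
        ((continuous_plaquetteHolonomy x μ ν).comp (continuous_anglePath U U'))
    have h2 : ContinuousAt (fun s => Complex.arg ((plaquetteHolonomy (anglePath U U' s) x μ ν :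
        Circle) : ℂ)) t :=
      ContinuousAt.comp (g := Complex.arg)
        (f := fun s => ((plaquetteHolonomy (anglePath U U' s) x μ ν : Circle) : ℂ))
        (Complex.continuousAt_arg (Circle.mem_slitPlane_of_ne_neg_one _ (hne t ht x)))
        hc.continuousAt
    exact h2.continuousWithinAt
  have hcont : ContinuousOn (fun t => topCharge x₀ μ ν (anglePath U U' t)) (Icc (0 : ℝ) 1) := by
    unfold topCharge magneticFlux
    exact ContinuousOn.div_const (continuousOn_finsetSum _ fun a _ =>
      continuousOn_finsetSum _ fun b _ => hF _) _
  -- intermediate value `1/2` between `Q(U') ≤ 0` and `Q(U) ≥ 1`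
  have h0 : topCharge x₀ μ ν (anglePath U U' 0) = topCharge x₀ μ ν U := by rw [anglePath_zero]
  have h1 : topCharge x₀ μ ν (anglePath U U' 1) = topCharge x₀ μ ν U' := by rw [anglePath_one]
  have hQU : 1 ≤ topCharge x₀ μ ν U := one_le_topCharge_of_pos (not_le.mp hUA')
  have hmem : (1 / 2 : ℝ) ∈
      Icc (topCharge x₀ μ ν (anglePath U U' 1)) (topCharge x₀ μ ν (anglePath U U' 0)) := by
    rw [h0, h1]; exact ⟨by linarith, by linarith⟩
  obtain ⟨t, _, ht⟩ := intermediate_value_Icc' zero_le_one hcont hmem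
  exact topCharge_ne_half x₀ μ ν (anglePath U U' t) ht

/-- **Collar bound for every finite measure**: `μ(A ∪ A^r) ≤ μ(A) + μ(collar 4r)`. [folklore] -/
theorem measureReal_union_thickening_le_collar (x₀ : Site d L) (μ ν : Fin d)
    (m : Measure (GaugeConfig d L Circle)) [IsFiniteMeasure m] (r : ℝ) :
    m.real ({U | topCharge x₀ μ ν U ≤ 0} ∪ thickening r {U | topCharge x₀ μ ν U ≤ 0}) ≤
      m.real {U | topCharge x₀ μ ν U ≤ 0} + m.real (collar μ ν (4 * r)) := by
  refine (measureReal_mono (fun U hU => ?_) (measure_ne_top _ _)).trans (measureReal_union_le _ _)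
  by_cases hA : topCharge x₀ μ ν U ≤ 0
  · exact Or.inl hA
  · exact Or.inr (union_thickening_diff_subset_collar x₀ μ ν r ⟨hU, hA⟩)

end Collar

/-! ## §3. The flux-sector (topological) transport law for compact `U(1)` -/

section Law

variable {d L : ℕ} [NeZero L]

/-- **Topological transport law (C2b′), lattice half PROVED.**  Let `γ` be a finite prior on a
metric space with the linear isoperimetric profile `(a, b, c)` (`min(γ(B) + c·s, b) ≤ γ(B ∪ B^s)`
whenever `γ(B) ≥ a`), `T` a `K`-Lipschitz map into `U(1)` configurations (sup metric) whose
push-forward is `ε`-close to a finite measure `μ` on measurable sets, `A = {Q ≤ 0}`, and suppose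
the window `a ≤ μ(A) − ε`, `μ(A) + ε + μ(collar 4r) < b`.  Then `c·r ≤ K·(2ε + μ(collar 4r))`:
the Lipschitz cost is linear in `1/ε` and capped by the collar mass. [folklore] -/
theorem accurateTransport_lipschitz_ge_collar {Y : Type*} [PseudoMetricSpace Y] [MeasurableSpace Y]
    [OpensMeasurableSpace Y] {γ : Measure Y} [IsFiniteMeasure γ] {a b c : ℝ}
    (hγ : ∀ B : Set Y, MeasurableSet B → a ≤ γ.real B → ∀ s : ℝ, 0 ≤ s →
      min (γ.real B + c * s) b ≤ γ.real (B ∪ thickening s B))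
    {T : Y → GaugeConfig d L Circle} {K : NNReal} (hT : LipschitzWith K T) (hK : 0 < (K : ℝ))
    {m : Measure (GaugeConfig d L Circle)} [IsFiniteMeasure m] (x₀ : Site d L) (μ ν : Fin d)
    {r ε : ℝ} (hr : 0 ≤ r)
    (hacc : ∀ S : Set (GaugeConfig d L Circle), MeasurableSet S → |m.real S - (γ.map T).real S| ≤ ε)
    (ha : a ≤ m.real {U | topCharge x₀ μ ν U ≤ 0} - ε)
    (hb : m.real {U | topCharge x₀ μ ν U ≤ 0} + ε + m.real (collar μ ν (4 * r)) < b) :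
    c * r ≤ K * (2 * ε + m.real (collar μ ν (4 * r))) := by
  have hA : MeasurableSet {U : GaugeConfig d L Circle | topCharge x₀ μ ν U ≤ 0} :=
    measurableSet_topCharge_le x₀ μ ν
  obtain ⟨h₁, h₂⟩ := Theory2.setwise_of_forall hacc hA r
  exact Theory2.accurateTransport_lipschitz_ge hγ hT hK hA hr h₁ h₂
    (measureReal_union_thickening_le_collar x₀ μ ν m r) ha hb

/-- **Exact case**: an EXACT `K`-Lipschitz transport `T_*γ = μ` obeys `c·r ≤ K·μ(collar 4r)`
whenever `a ≤ μ(A)` and `μ(A) + μ(collar 4r) < b`. [folklore] -/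
theorem exactTransport_lipschitz_ge_collar {Y : Type*} [PseudoMetricSpace Y] [MeasurableSpace Y]
    [OpensMeasurableSpace Y] {γ : Measure Y} [IsFiniteMeasure γ] {a b c : ℝ}
    (hγ : ∀ B : Set Y, MeasurableSet B → a ≤ γ.real B → ∀ s : ℝ, 0 ≤ s →
      min (γ.real B + c * s) b ≤ γ.real (B ∪ thickening s B))
    {T : Y → GaugeConfig d L Circle} {K : NNReal} (hT : LipschitzWith K T) (hK : 0 < (K : ℝ))
    {m : Measure (GaugeConfig d L Circle)} [IsFiniteMeasure m] (hex : γ.map T = m) (x₀ : Site d L)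
    (μ ν : Fin d) {r : ℝ} (hr : 0 ≤ r) (ha : a ≤ m.real {U | topCharge x₀ μ ν U ≤ 0})
    (hb : m.real {U | topCharge x₀ μ ν U ≤ 0} + m.real (collar μ ν (4 * r)) < b) :
    c * r ≤ K * m.real (collar μ ν (4 * r)) :=
  Theory2.exactTransport_lipschitz_ge hγ hT hK hex (measurableSet_topCharge_le x₀ μ ν) hr
    (measureReal_union_thickening_le_collar x₀ μ ν m r) ha hb

end Law

end Summit.Ventures.LatticeQCDFlow.Theory2.Lattice.Flux

end
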